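import Literature.NumberTheory.Rogawski1990.TamagawaSingularCovolTowerOfPartners          -- ★ p844899 (W9) J1 `exists_covolTower_of_partners` (+ ★ p844690 Covol, ★ p844223 FinTF)
import Literature.NumberTheory.Automorphic.UnitaryGroupOfLocalCovolumeStableKit            -- ★ (O10-c4-b): the §0 instance kit and the `ν_f`-independence ∕ `ν_∞`-pinning pattern
import Literature.NumberTheory.Automorphic.UnitaryGroupAdelicHaarOfLocal                   -- ★ `map_localPiEquiv_symm_apply_localInt_eq_one`, `isHaarMeasure_map_localModel_symm`, `isHaarMeasure_map_finAdelicEquiv_symm_rpMeasure`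
import Literature.MeasureTheory.Measure.ProdLeftCancel                                     -- ★ `Literature.MeasureTheory.Measure.eq_of_map_mulEquiv_prod_eq` (Gelbart's Remark 9.23)
import HarnessLib

/-!
# ROAD F′ (W9), FILE J2a — at a singular non-central class, a (K7-s) Weil partner `νZ_c` of `ofLocal mGs TF` IS `κ •` the (T′) tower, with ONE archimedean scalar
# `κ = haarScalarFactor νi νGi` read off any reference decomposition `νA = e_* (νi ⊗ ν_f)` (Rogawski 1990 §1.7 p. 6, §5.4 p. 72, §14.5 p. 239; Gelbart 1975 Remark 9.23)

Topic `NumberTheory/Rogawski1990`; namespace `Literature.NumberTheory.Rogawski1990`.  THEOREMS ONLY (no `def`, no instance, no notation, no named fact, no `sorry`).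
Cell `pub/hodgecm-mathlib`, crux H413 = stmt-HodgeConjecture-24833; ROAD F′ «S1finTF ⟸ COVOL» (LEAD F0P3a-plan (g10) T9-40 (d3); owner F0P3a-p07 (g10) SPEC (W9)
4a4af3d0d52254ea, steps 2–3 per class); F0P3-p02 (g13).  Count-neutral.  HONEST LABEL: HC_CM is proved only modulo the printed citations until rung 0 closes.

WHAT.  Sequel of ★ J1 `exists_covolTower_of_partners` (p844899), split off so that each declaration stays inside ★ O10-s's heartbeat budget.  Fix a reference
decomposition `νA = e_* (νi₁ ⊗ ν_f(S₁))` of the adelic Haar measure with `ν_f(S₁)` the finite-adelic level measure over some exceptional set `S₁` (★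
`UnitaryGroup.exists_isHaarMeasure_arch_eq_map_prod_rpMeasure`).  At a singular non-central class `c` with `mGs` normalised off `S₀` and a Haar, inversion-invariant
`νZ_c` on `Z_c(𝔸)` reading `ofLocal mGs TF c = dνA ∕ dνZ_c` (the (K7-s) antecedent): ★ J1 gives `ofLocal mGs TF c = dνA ∕ d(κ_c • T)` with `T` the (T′) tower and
`κ_c = haarScalarFactor νi_c νGi`, `νA = e_* (νi_c ⊗ ν_f(S₀))`; the level measure does not depend on the exceptional set (★ `rpMeasure_eq_of_subset`, `hK` at EVERY place),
so `νi_c = νi₁` (★ `eq_of_map_mulEquiv_prod_eq`) and `κ_c = κ := haarScalarFactor νi₁ νGi`; uniqueness of the Weil partner (★ `isHaarMeasure_eq_of_quotientMeasure_eq`)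
gives `νZ_c = κ • T`, i.e. **`κ⁻¹ • νZ_c` satisfies the (T′) tower equations of ★ `TamagawaSingularMembersFinTFCovol` over `S₀` VERBATIM**.  Consumer: J2
`tamagawaSingularMembersFinTF_of_finTFCovol` (the family `κ⁻¹ • νZ` meets (T′)'s antecedent; `κ⁻¹` cancels in the covolumes).

* **`covolTower_of_partner_eq`** — the per-class identification (J2a).

## References
* [Rogawski1990] J. D. Rogawski, *Automorphic Representations of Unitary Groups in Three Variables*, Ann. of Math. Stud. 123 (1990), §1.7 p. 6, p. 11; §4.3 pp. 43–44; §5.4 p. 72;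
  §14.5 Lemma 14.5.2 (b) pp. 238–239.
* [Kottwitz1988] R. E. Kottwitz, *Tamagawa numbers*, Ann. of Math. 127 (1988), Prop. 2.
* [DeitmarEchterhoff2014] A. Deitmar, S. Echterhoff, *Principles of Harmonic Analysis*, 2nd ed. (2014), Thm. 1.5.3.
* [Gelbart1975] S. Gelbart, *Automorphic forms on adele groups* (1975), Remark 9.23, p. 155 (10.19).
-/

set_option autoImplicit false

noncomputable section

open MeasureTheory Measure NumberField IsDedekindDomain
open Literature.MeasureTheory.Group Literature.MeasureTheory.RestrictedProduct
open Literature.Topology.RestrictedProduct Literature.Topology.Algebra.RestrictedProduct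
open Literature.NumberTheory.Automorphic
open Literature.AlgebraicGeometry.ShimuraVarieties (unitaryGroup hermForm)
open scoped Matrix MatrixGroups RestrictedProduct NNReal ENNReal

namespace Literature.NumberTheory.Rogawski1990

section PerClass

variable (L : Type) [Field L] [NumberField L] [IsCMField L] (H' : Matrix (Fin 3) (Fin 3) L)
  [∀ g : (UnitaryGroup.cmDatum L 3 H').Adelic, MeasurableSpace ((UnitaryGroup.cmDatum L 3 H').Adelic ⧸ Subgroup.centralizer ({g} : Set (UnitaryGroup.cmDatum L 3 H').Adelic))]
  [∀ g : (UnitaryGroup.cmDatum L 3 H').Adelic, BorelSpace ((UnitaryGroup.cmDatum L 3 H').Adelic ⧸ Subgroup.centralizer ({g} : Set (UnitaryGroup.cmDatum L 3 H').Adelic))]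
  [∀ a : UnitaryGroup.arch (↥(maximalRealSubfield L)) L (IsCMField.complexConj L) 3 H', MeasurableSpace (UnitaryGroup.arch (↥(maximalRealSubfield L)) L (IsCMField.complexConj L) 3 H' ⧸ Subgroup.centralizer ({a} : Set (UnitaryGroup.arch (↥(maximalRealSubfield L)) L (IsCMField.complexConj L) 3 H')))]
  [∀ a : UnitaryGroup.arch (↥(maximalRealSubfield L)) L (IsCMField.complexConj L) 3 H', BorelSpace (UnitaryGroup.arch (↥(maximalRealSubfield L)) L (IsCMField.complexConj L) 3 H' ⧸ Subgroup.centralizer ({a} : Set (UnitaryGroup.arch (↥(maximalRealSubfield L)) L (IsCMField.complexConj L) 3 H')))]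
  [∀ (v : HeightOneSpectrum (𝓞 ↥(maximalRealSubfield L))) (x : (UnitaryGroup.cmDatum L 3 H').Local v), MeasurableSpace ((UnitaryGroup.cmDatum L 3 H').Local v ⧸ Subgroup.centralizer ({x} : Set ((UnitaryGroup.cmDatum L 3 H').Local v)))]
  [∀ (v : HeightOneSpectrum (𝓞 ↥(maximalRealSubfield L))) (x : (UnitaryGroup.cmDatum L 3 H').Local v), BorelSpace ((UnitaryGroup.cmDatum L 3 H').Local v ⧸ Subgroup.centralizer ({x} : Set ((UnitaryGroup.cmDatum L 3 H').Local v)))]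
  [∀ v : HeightOneSpectrum (𝓞 ↥(maximalRealSubfield L)), MeasurableSpace ((UnitaryGroup.cmDatum L 3 H').Local v)] [∀ v : HeightOneSpectrum (𝓞 ↥(maximalRealSubfield L)), BorelSpace ((UnitaryGroup.cmDatum L 3 H').Local v)]
  [∀ v : HeightOneSpectrum (𝓞 ↥(maximalRealSubfield L)), MeasurableSpace ↥(UnitaryGroup.localPi L (IsCMField.complexConj L) 3 H' v)]
  [∀ v : HeightOneSpectrum (𝓞 ↥(maximalRealSubfield L)), BorelSpace ↥(UnitaryGroup.localPi L (IsCMField.complexConj L) 3 H' v)]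
  [MeasurableSpace ↥(UnitaryGroup.finAdelic (↥(maximalRealSubfield L)) L (IsCMField.complexConj L) 3 H')] [BorelSpace ↥(UnitaryGroup.finAdelic (↥(maximalRealSubfield L)) L (IsCMField.complexConj L) 3 H')]
  [MeasurableSpace (UnitaryGroup.cmDatum L 3 H').Adelic] [BorelSpace (UnitaryGroup.cmDatum L 3 H').Adelic]
  [MeasurableSpace (UnitaryGroup.arch (↥(maximalRealSubfield L)) L (IsCMField.complexConj L) 3 H')] [BorelSpace (UnitaryGroup.arch (↥(maximalRealSubfield L)) L (IsCMField.complexConj L) 3 H')]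

set_option maxHeartbeats 16000000 in
set_option synthInstance.maxHeartbeats 800000 in
-- HB: one instantiation of ★ J1 (★ O10-s's tower types) on the concrete `cmDatum` ∕ restricted-product carriers (★ O10-s's own budget)
/-- **(W9)∕J2a — A (K7-s) PARTNER IS `κ •` THE (T′) TOWER, WITH A CLASS-INDEPENDENT `κ`.**  In the setting of ★ `exists_covolTower_of_partners` (`hanis … hg`), fix an
archimedean Haar measure `νi₁` and an exceptional set `S₁` with `νA = e_* (νi₁ ⊗ (finAdelicEquiv⁻¹)_* ∏'_v (ψ_v⁻¹_* νG_v ; S₁))` (`hνA₁`).  Let `c` be singular (`hreg`)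
non-central (`hcen`), `mGs` normalised at `γ_c` off `S₀` (`hS₀`), and `νZc` a Haar inversion-invariant measure on `Z_c(𝔸)` with `ofLocal mGs TF c = quotientMeasure Z_c(𝔸) νZc νA`
(`hq`).  THEN `(haarScalarFactor νi₁ νGi)⁻¹ • νZc` satisfies the (T′) tower equations of ★ `TamagawaSingularMembersFinTFCovol` over `S₀` (verbatim ∃-body).
[cite: Rogawski1990, §1.7 p. 6; §5.4 p. 72; §14.5 Lemma 14.5.2 (b) p. 239] [cite: Gelbart1975, Remark 9.23] [cite: DeitmarEchterhoff2014, Thm. 1.5.3] [cite: Kottwitz1988, Prop. 2] -/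
theorem covolTower_of_partner_eq
    (hanis : ∀ x : Fin 3 → L, hermForm (cmConjRingHom L) H' x x = 0 → x = 0) (hherm : (H'.map (cmConjRingHom L))ᵀ = H')
    (νG : ∀ v : HeightOneSpectrum (𝓞 ↥(maximalRealSubfield L)), Measure ((UnitaryGroup.cmDatum L 3 H').Local v)) [∀ v, (νG v).IsHaarMeasure] [∀ v, (νG v).IsMulRightInvariant]
    (hK : ∀ v : HeightOneSpectrum (𝓞 ↥(maximalRealSubfield L)), νG v (UnitaryGroup.cmLocalIntegralLevel L 3 H' v : Set ((UnitaryGroup.cmDatum L 3 H').Local v)) = 1)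
    (mGs : ∀ v : HeightOneSpectrum (𝓞 ↥(maximalRealSubfield L)), OrbitalMeasureFamily ((UnitaryGroup.cmDatum L 3 H').Local v))
    (tGs : ∀ (v : HeightOneSpectrum (𝓞 ↥(maximalRealSubfield L))) (γ : (UnitaryGroup.cmDatum L 3 H').Local v), Measure ↥(Subgroup.centralizer ({γ} : Set ((UnitaryGroup.cmDatum L 3 H').Local v))))
    (hQ : ∀ v, (mGs v).IsQuotientOf (fun x : (UnitaryGroup.cmDatum L 3 H').Local v => ∃ γ₀ : (UnitaryGroup.cmDatum L 3 H').Rational, ¬ IsRegularElt (γ₀.val : GL (Fin 3) L) ∧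
            Corresponds (UnitaryGroup.conjLocal L (IsCMField.complexConj L) v)
              ((UnitaryGroup.adelicForm L 3 H').map (UnitaryGroup.adeleToLocal L v))
              ((UnitaryGroup.adelicForm L 3 H').map (UnitaryGroup.adeleToLocal L v))
              ((UnitaryGroup.cmDatum L 3 H').toLocal v ((UnitaryGroup.cmDatum L 3 H').toAdelic γ₀)) x) (νG v) (tGs v))
    (hCoh : ∀ (v : HeightOneSpectrum (𝓞 ↥(maximalRealSubfield L))) (γ₁ γ₂ q : (UnitaryGroup.cmDatum L 3 H').Local v) (hq : (MulAut.conj q : (UnitaryGroup.cmDatum L 3 H').Local v ≃* (UnitaryGroup.cmDatum L 3 H').Local v) γ₁ = γ₂),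
        (∃ γ₀ : (UnitaryGroup.cmDatum L 3 H').Rational, ¬ IsRegularElt (γ₀.val : GL (Fin 3) L) ∧
            Corresponds (UnitaryGroup.conjLocal L (IsCMField.complexConj L) v)
              ((UnitaryGroup.adelicForm L 3 H').map (UnitaryGroup.adeleToLocal L v))
              ((UnitaryGroup.adelicForm L 3 H').map (UnitaryGroup.adeleToLocal L v))
              ((UnitaryGroup.cmDatum L 3 H').toLocal v ((UnitaryGroup.cmDatum L 3 H').toAdelic γ₀)) γ₁) →
        Measure.map (subgroupCongrHomeomorph (MulAut.conj q : (UnitaryGroup.cmDatum L 3 H').Local v ≃* (UnitaryGroup.cmDatum L 3 H').Local v) (Subgroup.centralizer ({γ₁} : Set ((UnitaryGroup.cmDatum L 3 H').Local v)))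
          (Subgroup.centralizer ({γ₂} : Set ((UnitaryGroup.cmDatum L 3 H').Local v))) (forall_apply_mem_centralizer_singleton_iff_of_eq (MulAut.conj q : (UnitaryGroup.cmDatum L 3 H').Local v ≃* (UnitaryGroup.cmDatum L 3 H').Local v) hq)
          (continuous_mulAutConj q) (continuous_mulAutConj_symm q)) (tGs v γ₁) = tGs v γ₂)
    (νGi : Measure (UnitaryGroup.arch (↥(maximalRealSubfield L)) L (IsCMField.complexConj L) 3 H')) [νGi.IsHaarMeasure] [νGi.IsMulRightInvariant]
    (νA : Measure (UnitaryGroup.cmDatum L 3 H').Adelic) [νA.IsHaarMeasure]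
    (ψ : ∀ v : HeightOneSpectrum (𝓞 ↥(maximalRealSubfield L)), ↥(UnitaryGroup.localPi L (IsCMField.complexConj L) 3 H' v) ≃ₜ* (UnitaryGroup.cmDatum L 3 H').Local v)
    (hψ : ψ = fun v => UnitaryGroup.localPiEquiv L (IsCMField.complexConj L) 3 H' v)
    (e : ↥(UnitaryGroup.arch (↥(maximalRealSubfield L)) L (IsCMField.complexConj L) 3 H') × ↥(UnitaryGroup.finAdelic (↥(maximalRealSubfield L)) L (IsCMField.complexConj L) 3 H') ≃* (UnitaryGroup.cmDatum L 3 H').Adelic)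
    (he' : e = (UnitaryGroup.adelicProdEquiv (↥(maximalRealSubfield L)) L (IsCMField.complexConj L) 3 H').symm.toMulEquiv) (he : Continuous e) (hes : Continuous e.symm)
    (hg : ∀ g : (UnitaryGroup.cmDatum L 3 H').Adelic, e (UnitaryGroup.archPart (↥(maximalRealSubfield L)) L (IsCMField.complexConj L) 3 H' g, UnitaryGroup.finPart (↥(maximalRealSubfield L)) L (IsCMField.complexConj L) 3 H' g) = g)
    [νA.IsMulRightInvariant]
    (νi₁ : Measure (UnitaryGroup.arch (↥(maximalRealSubfield L)) L (IsCMField.complexConj L) 3 H')) [νi₁.IsHaarMeasure] (S₁ : Finset (HeightOneSpectrum (𝓞 ↥(maximalRealSubfield L))))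
    (hνA₁ : νA = Measure.map e (νi₁.prod (Measure.map (UnitaryGroup.finAdelicEquiv (↥(maximalRealSubfield L)) L (IsCMField.complexConj L) 3 H').symm.toMulEquiv (rpMeasure (fun v => (UnitaryGroup.localInt L (IsCMField.complexConj L) 3 H' v : Set ↥(UnitaryGroup.localPi L (IsCMField.complexConj L) 3 H' v))) (fun v => (Measure.map (ψ v).symm (νG v))) S₁))))
    (c : ConjClasses (UnitaryGroup.cmDatum L 3 H').Rational) (hreg : ¬ IsRegularElt ((Quotient.out c).val : GL (Fin 3) L))
    (hcen : ¬ ∃ ζ : L, (((Quotient.out c).val : GL (Fin 3) L) : Matrix (Fin 3) (Fin 3) L) = ζ • (1 : Matrix (Fin 3) (Fin 3) L))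
    (S₀ : Finset (HeightOneSpectrum (𝓞 ↥(maximalRealSubfield L)))) (hS₀ : UnitaryGroup.IsNormalisedOff L 3 H' mGs ((UnitaryGroup.cmDatum L 3 H').toAdelic (Quotient.out c)) S₀)
    (νZc : Measure ↥(Subgroup.centralizer ({((UnitaryGroup.cmDatum L 3 H').toAdelic (Quotient.out c))} : Set (UnitaryGroup.cmDatum L 3 H').Adelic))) [νZc.IsHaarMeasure] [νZc.IsInvInvariant]
    (hq : UnitaryGroup.AdelicOrbitalMeasureFamily.ofLocal L 3 H' mGs (Literature.NumberTheory.Weil1964.UnitaryArchTopForm.archSingularTopFormFamily L H' νGi) c = quotientMeasure (Subgroup.centralizer ({((UnitaryGroup.cmDatum L 3 H').toAdelic (Quotient.out c))} : Set (UnitaryGroup.cmDatum L 3 H').Adelic)) νZc (isClosed_coe_centralizer_singleton _) νA) :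
    ∃ (ρ : Measure (cutout (fun v => UnitaryGroup.localInt L (IsCMField.complexConj L) 3 H' v) (fun v => (Subgroup.centralizer ({(UnitaryGroup.finAdelicEquiv (↥(maximalRealSubfield L)) L (IsCMField.complexConj L) 3 H') (UnitaryGroup.finPart (↥(maximalRealSubfield L)) L (IsCMField.complexConj L) 3 H' ((UnitaryGroup.cmDatum L 3 H').toAdelic (Quotient.out c))) v} : Set ↥(UnitaryGroup.localPi L (IsCMField.complexConj L) 3 H' v)))))) (ρM : Measure (Subgroup.centralizer ({(UnitaryGroup.finAdelicEquiv (↥(maximalRealSubfield L)) L (IsCMField.complexConj L) 3 H') (UnitaryGroup.finPart (↥(maximalRealSubfield L)) L (IsCMField.complexConj L) 3 H' ((UnitaryGroup.cmDatum L 3 H').toAdelic (Quotient.out c)))} : Set (Πʳ v : HeightOneSpectrum (𝓞 ↥(maximalRealSubfield L)), [↥(UnitaryGroup.localPi L (IsCMField.complexConj L) 3 H' v), UnitaryGroup.localInt L (IsCMField.complexConj L) 3 H' v])))) (tf : Measure (Subgroup.centralizer ({(UnitaryGroup.finPart (↥(maximalRealSubfield L)) L (IsCMField.complexConj L) 3 H'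 ((UnitaryGroup.cmDatum L 3 H').toAdelic (Quotient.out c)))} : Set (UnitaryGroup.finAdelic (↥(maximalRealSubfield L)) L (IsCMField.complexConj L) 3 H'))))
            (tP : Measure ((Subgroup.centralizer ({UnitaryGroup.archPart (↥(maximalRealSubfield L)) L (IsCMField.complexConj L) 3 H' ((UnitaryGroup.cmDatum L 3 H').toAdelic (Quotient.out c))} : Set (UnitaryGroup.arch (↥(maximalRealSubfield L)) L (IsCMField.complexConj L) 3 H'))).prod (Subgroup.centralizer ({(UnitaryGroup.finPart (↥(maximalRealSubfield L)) L (IsCMField.complexConj L) 3 H' ((UnitaryGroup.cmDatum L 3 H').toAdelic (Quotient.out c)))} : Set (UnitaryGroup.finAdelic (↥(maximalRealSubfield L)) L (IsCMField.complexConj L) 3 H'))))),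
            -- the model local Weil partners give mass one to the level boxes off `S₀` (★ O10-s conjunct «ht1»)
            (∀ v, v ∉ S₀ → (Measure.map (subgroupCongrHomeomorph (ψ v).symm.toMulEquiv (Subgroup.centralizer ({((UnitaryGroup.cmDatum L 3 H').toLocal v ((UnitaryGroup.cmDatum L 3 H').toAdelic (Quotient.out c)))} : Set ((UnitaryGroup.cmDatum L 3 H').Local v))) (Subgroup.centralizer ({(UnitaryGroup.finAdelicEquiv (↥(maximalRealSubfield L)) L (IsCMField.complexConj L) 3 H') (UnitaryGroup.finPart (↥(maximalRealSubfield L)) L (IsCMField.complexConj L) 3 H' ((UnitaryGroup.cmDatum L 3 H').toAdelic (Quotient.out c))) v} : Set ↥(UnitaryGroup.localPi L (IsCMField.complexConj L) 3 H' v))) (UnitaryGroup.localPiEquiv_symm_mem_centralizer_iff L 3 H' v ((UnitaryGroup.cmDatum L 3 H').toAdelic (Quotient.out c)) (ψ v) (congrFun hψ v)) (ψ v).symm.continuous (ψ v).continuous) (tGs v ((UnitaryGroup.cmDatum L 3 H').toLocal v ((UnitaryGroup.cmDatum L 3 H').toAdelic (Quotient.out c))))) ((((inH (fun v => UnitaryGroup.localInt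 L (IsCMField.complexConj L) 3 H' v) (fun v => (Subgroup.centralizer ({(UnitaryGroup.finAdelicEquiv (↥(maximalRealSubfield L)) L (IsCMField.complexConj L) 3 H') (UnitaryGroup.finPart (↥(maximalRealSubfield L)) L (IsCMField.complexConj L) 3 H' ((UnitaryGroup.cmDatum L 3 H').toAdelic (Quotient.out c))) v} : Set ↥(UnitaryGroup.localPi L (IsCMField.complexConj L) 3 H' v)))) v) : Subgroup (Subgroup.centralizer ({(UnitaryGroup.finAdelicEquiv (↥(maximalRealSubfield L)) L (IsCMField.complexConj L) 3 H') (UnitaryGroup.finPart (↥(maximalRealSubfield L)) L (IsCMField.complexConj L) 3 H' ((UnitaryGroup.cmDatum L 3 H').toAdelic (Quotient.out c))) v} : Set ↥(UnitaryGroup.localPi L (IsCMField.complexConj L) 3 H' v)))) : Set (Subgroup.centralizer ({(UnitaryGroup.finAdelicEquiv (↥(maximalRealSubfield L)) L (IsCMField.complexConj L) 3 H') (UnitaryGroup.finPart (↥(maximalRealSubfield L)) L (IsCMField.complexConj L) 3 H' ((UnitaryGroup.cmDatum L 3 H').toAdelic (Quotient.out c))) v} : Set ↥(UnitaryGroup.localPi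 L (IsCMField.complexConj L) 3 H' v))))) = 1) ∧
            -- the finite-adelic centraliser measure: restricted product of the model local partners, cut out and carried to `Z(γ_f) ≤ U(H)(𝔸_f)` (★ O10-s `ρ`, `ρM`, `tf`)
            ρ = Measure.map (cutoutEquiv (fun v => UnitaryGroup.localInt L (IsCMField.complexConj L) 3 H' v) (fun v => (Subgroup.centralizer ({(UnitaryGroup.finAdelicEquiv (↥(maximalRealSubfield L)) L (IsCMField.complexConj L) 3 H') (UnitaryGroup.finPart (↥(maximalRealSubfield L)) L (IsCMField.complexConj L) 3 H' ((UnitaryGroup.cmDatum L 3 H').toAdelic (Quotient.out c))) v} : Set ↥(UnitaryGroup.localPi L (IsCMField.complexConj L) 3 H' v)))))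
            (rpMeasure (fun v => (((inH (fun v => UnitaryGroup.localInt L (IsCMField.complexConj L) 3 H' v) (fun v => (Subgroup.centralizer ({(UnitaryGroup.finAdelicEquiv (↥(maximalRealSubfield L)) L (IsCMField.complexConj L) 3 H') (UnitaryGroup.finPart (↥(maximalRealSubfield L)) L (IsCMField.complexConj L) 3 H' ((UnitaryGroup.cmDatum L 3 H').toAdelic (Quotient.out c))) v} : Set ↥(UnitaryGroup.localPi L (IsCMField.complexConj L) 3 H' v)))) v) : Subgroup (Subgroup.centralizer ({(UnitaryGroup.finAdelicEquiv (↥(maximalRealSubfield L)) L (IsCMField.complexConj L) 3 H') (UnitaryGroup.finPart (↥(maximalRealSubfield L)) L (IsCMField.complexConj L) 3 H' ((UnitaryGroup.cmDatum L 3 H').toAdelic (Quotient.out c))) v} : Set ↥(UnitaryGroup.localPi L (IsCMField.complexConj L) 3 H' v)))) : Set (Subgroup.centralizer ({(UnitaryGroup.finAdelicEquiv (↥(maximalRealSubfield L)) L (IsCMField.complexConj L) 3 H') (UnitaryGroup.finPart (↥(maximalRealSubfield L)) L (IsCMField.complexConj L) 3 H' ((UnitaryGroup.cmDatum L 3 H').toAdelic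 (Quotient.out c))) v} : Set ↥(UnitaryGroup.localPi L (IsCMField.complexConj L) 3 H' v))))) (fun v => (Measure.map (subgroupCongrHomeomorph (ψ v).symm.toMulEquiv (Subgroup.centralizer ({((UnitaryGroup.cmDatum L 3 H').toLocal v ((UnitaryGroup.cmDatum L 3 H').toAdelic (Quotient.out c)))} : Set ((UnitaryGroup.cmDatum L 3 H').Local v))) (Subgroup.centralizer ({(UnitaryGroup.finAdelicEquiv (↥(maximalRealSubfield L)) L (IsCMField.complexConj L) 3 H') (UnitaryGroup.finPart (↥(maximalRealSubfield L)) L (IsCMField.complexConj L) 3 H' ((UnitaryGroup.cmDatum L 3 H').toAdelic (Quotient.out c))) v} : Set ↥(UnitaryGroup.localPi L (IsCMField.complexConj L) 3 H' v))) (UnitaryGroup.localPiEquiv_symm_mem_centralizer_iff L 3 H' v ((UnitaryGroup.cmDatum L 3 H').toAdelic (Quotient.out c)) (ψ v) (congrFun hψ v)) (ψ v).symm.continuous (ψ v).continuous) (tGs v ((UnitaryGroup.cmDatum L 3 H').toLocal v ((UnitaryGroup.cmDatum L 3 H').toAdelic (Quotient.out c)))))) S₀) ∧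
            ρM = Measure.map (subgroupCongrHomeomorph (MulEquiv.refl (Πʳ v : HeightOneSpectrum (𝓞 ↥(maximalRealSubfield L)), [↥(UnitaryGroup.localPi L (IsCMField.complexConj L) 3 H' v), UnitaryGroup.localInt L (IsCMField.complexConj L) 3 H' v])) (cutout (fun v => UnitaryGroup.localInt L (IsCMField.complexConj L) 3 H' v) (fun v => (Subgroup.centralizer ({(UnitaryGroup.finAdelicEquiv (↥(maximalRealSubfield L)) L (IsCMField.complexConj L) 3 H') (UnitaryGroup.finPart (↥(maximalRealSubfield L)) L (IsCMField.complexConj L) 3 H' ((UnitaryGroup.cmDatum L 3 H').toAdelic (Quotient.out c))) v} : Set ↥(UnitaryGroup.localPi L (IsCMField.complexConj L) 3 H' v))))) (Subgroup.centralizer ({(UnitaryGroup.finAdelicEquiv (↥(maximalRealSubfield L)) L (IsCMField.complexConj L) 3 H') (UnitaryGroup.finPart (↥(maximalRealSubfield L)) L (IsCMField.complexConj L) 3 H' ((UnitaryGroup.cmDatum L 3 H').toAdelic (Quotient.out c)))} : Set (Πʳ v : HeightOneSpectrum (𝓞 ↥(maximalRealSubfield L)), [↥(UnitaryGroup.localPi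 L (IsCMField.complexConj L) 3 H' v), UnitaryGroup.localInt L (IsCMField.complexConj L) 3 H' v]))) (forall_refl_mem_iff (fun v => UnitaryGroup.localInt L (IsCMField.complexConj L) 3 H' v) (fun v => (Subgroup.centralizer ({(UnitaryGroup.finAdelicEquiv (↥(maximalRealSubfield L)) L (IsCMField.complexConj L) 3 H') (UnitaryGroup.finPart (↥(maximalRealSubfield L)) L (IsCMField.complexConj L) 3 H' ((UnitaryGroup.cmDatum L 3 H').toAdelic (Quotient.out c))) v} : Set ↥(UnitaryGroup.localPi L (IsCMField.complexConj L) 3 H' v)))) _ (mem_centralizer_singleton_iff_forall_mem (fun v => UnitaryGroup.localInt L (IsCMField.complexConj L) 3 H' v) ((UnitaryGroup.finAdelicEquiv (↥(maximalRealSubfield L)) L (IsCMField.complexConj L) 3 H') (UnitaryGroup.finPart (↥(maximalRealSubfield L)) L (IsCMField.complexConj L) 3 H' ((UnitaryGroup.cmDatum L 3 H').toAdelic (Quotient.out c)))))) continuous_id continuous_id) ρ ∧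
            tf = Measure.map (subgroupCongrHomeomorph (UnitaryGroup.finAdelicEquiv (↥(maximalRealSubfield L)) L (IsCMField.complexConj L) 3 H').symm.toMulEquiv (Subgroup.centralizer ({(UnitaryGroup.finAdelicEquiv (↥(maximalRealSubfield L)) L (IsCMField.complexConj L) 3 H') (UnitaryGroup.finPart (↥(maximalRealSubfield L)) L (IsCMField.complexConj L) 3 H' ((UnitaryGroup.cmDatum L 3 H').toAdelic (Quotient.out c)))} : Set (Πʳ v : HeightOneSpectrum (𝓞 ↥(maximalRealSubfield L)), [↥(UnitaryGroup.localPi L (IsCMField.complexConj L) 3 H' v), UnitaryGroup.localInt L (IsCMField.complexConj L) 3 H' v]))) (Subgroup.centralizer ({(UnitaryGroup.finPart (↥(maximalRealSubfield L)) L (IsCMField.complexConj L) 3 H' ((UnitaryGroup.cmDatum L 3 H').toAdelic (Quotient.out c)))} : Set (UnitaryGroup.finAdelic (↥(maximalRealSubfield L)) L (IsCMField.complexConj L) 3 H'))) (forall_apply_mem_centralizer_singleton_iff_of_eq (UnitaryGroup.finAdelicEquiv (↥(maximalRealSubfield L)) L (IsCMField.complexConj L) 3 H').symm.toMulEquiv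 ((UnitaryGroup.finAdelicEquiv (↥(maximalRealSubfield L)) L (IsCMField.complexConj L) 3 H').symm_apply_apply (UnitaryGroup.finPart (↥(maximalRealSubfield L)) L (IsCMField.complexConj L) 3 H' ((UnitaryGroup.cmDatum L 3 H').toAdelic (Quotient.out c))))) (UnitaryGroup.finAdelicEquiv (↥(maximalRealSubfield L)) L (IsCMField.complexConj L) 3 H').symm.continuous (UnitaryGroup.finAdelicEquiv (↥(maximalRealSubfield L)) L (IsCMField.complexConj L) 3 H').continuous) ρM ∧
            -- the archimedean factor is the TOP-FORM centraliser measure [§1.7 p. 6 «dg = c|Ω|_v»] and `tA c` is the product carried along `e` (★ O10-s `tP`, `tA` with `ti := centralizerTopFormHaar`)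
            Measure.map (Subgroup.prodEquiv (Subgroup.centralizer ({UnitaryGroup.archPart (↥(maximalRealSubfield L)) L (IsCMField.complexConj L) 3 H' ((UnitaryGroup.cmDatum L 3 H').toAdelic (Quotient.out c))} : Set (UnitaryGroup.arch (↥(maximalRealSubfield L)) L (IsCMField.complexConj L) 3 H'))) (Subgroup.centralizer ({(UnitaryGroup.finPart (↥(maximalRealSubfield L)) L (IsCMField.complexConj L) 3 H' ((UnitaryGroup.cmDatum L 3 H').toAdelic (Quotient.out c)))} : Set (UnitaryGroup.finAdelic (↥(maximalRealSubfield L)) L (IsCMField.complexConj L) 3 H')))) tP = (Literature.NumberTheory.Weil1964.UnitaryArchTopForm.centralizerTopFormHaar L H' (UnitaryGroup.archPart (↥(maximalRealSubfield L)) L (IsCMField.complexConj L) 3 H' ((UnitaryGroup.cmDatum L 3 H').toAdelic (Quotient.out c)))).prod tf ∧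
            ((Measure.haarScalarFactor νi₁ νGi)⁻¹ • νZc : Measure _) = Measure.map (subgroupCongrHomeomorph e ((Subgroup.centralizer ({UnitaryGroup.archPart (↥(maximalRealSubfield L)) L (IsCMField.complexConj L) 3 H' ((UnitaryGroup.cmDatum L 3 H').toAdelic (Quotient.out c))} : Set (UnitaryGroup.arch (↥(maximalRealSubfield L)) L (IsCMField.complexConj L) 3 H'))).prod (Subgroup.centralizer ({(UnitaryGroup.finPart (↥(maximalRealSubfield L)) L (IsCMField.complexConj L) 3 H' ((UnitaryGroup.cmDatum L 3 H').toAdelic (Quotient.out c)))} : Set (UnitaryGroup.finAdelic (↥(maximalRealSubfield L)) L (IsCMField.complexConj L) 3 H')))) (Subgroup.centralizer ({((UnitaryGroup.cmDatum L 3 H').toAdelic (Quotient.out c))} : Set (UnitaryGroup.cmDatum L 3 H').Adelic)) (forall_apply_mem_centralizer_iff e (hg ((UnitaryGroup.cmDatum L 3 H').toAdelic (Quotient.out c)))) he hes) tP := by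
  classical
  -- §0 ambient instances (as in ★ (c4-a))
  haveI : Countable (HeightOneSpectrum (𝓞 ↥(maximalRealSubfield L))) := countable_heightOneSpectrum ↥(maximalRealSubfield L)
  haveI : ∀ v, SecondCountableTopology ↥(UnitaryGroup.localPi L (IsCMField.complexConj L) 3 H' v) := fun v => UnitaryGroup.secondCountableTopology_localPi L 3 (IsCMField.complexConj L) H' v
  haveI : ∀ v, LocallyCompactSpace ↥(UnitaryGroup.localPi L (IsCMField.complexConj L) 3 H' v) := fun v => UnitaryGroup.locallyCompactSpace_localPi L 3 (IsCMField.complexConj L) H' v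
  haveI : LocallyCompactSpace (UnitaryGroup.finAdelic (↥(maximalRealSubfield L)) L (IsCMField.complexConj L) 3 H') := UnitaryGroup.locallyCompactSpace_finAdelic (↥(maximalRealSubfield L)) L (IsCMField.complexConj L) 3 H'
  haveI : SecondCountableTopology (UnitaryGroup.finAdelic (↥(maximalRealSubfield L)) L (IsCMField.complexConj L) 3 H') := UnitaryGroup.secondCountableTopology_finAdelic (↥(maximalRealSubfield L)) L (IsCMField.complexConj L) 3 H'
  haveI : T2Space (UnitaryGroup.finAdelic (↥(maximalRealSubfield L)) L (IsCMField.complexConj L) 3 H') := UnitaryGroup.t2Space_finAdelic (↥(maximalRealSubfield L)) L (IsCMField.complexConj L) 3 H'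
  haveI : LocallyCompactSpace (UnitaryGroup.cmDatum L 3 H').Adelic := UnitaryGroup.locallyCompactSpace_cmDatum_Adelic L 3 H'
  haveI : SecondCountableTopology (UnitaryGroup.cmDatum L 3 H').Adelic := UnitaryGroup.secondCountableTopology_cmDatum_Adelic L 3 H'
  haveI : T2Space (UnitaryGroup.cmDatum L 3 H').Adelic := UnitaryGroup.t2Space_cmDatum_Adelic L 3 H'
  haveI hKc : ∀ v, CompactSpace (UnitaryGroup.localInt L (IsCMField.complexConj L) 3 H' v) := fun v => isCompact_iff_compactSpace.1 (UnitaryGroup.isCompact_localInt L (IsCMField.complexConj L) 3 H' v)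
  haveI : BorelSpace (Πʳ v : HeightOneSpectrum (𝓞 ↥(maximalRealSubfield L)), [↥(UnitaryGroup.localPi L (IsCMField.complexConj L) 3 H' v), UnitaryGroup.localInt L (IsCMField.complexConj L) 3 H' v]) :=
    borelSpace (fun v => (UnitaryGroup.localInt L (IsCMField.complexConj L) 3 H' v : Set ↥(UnitaryGroup.localPi L (IsCMField.complexConj L) 3 H' v))) fun v => (UnitaryGroup.isOpen_localInt L (IsCMField.complexConj L) 3 H' v).measurableSet
  haveI : SecondCountableTopology (Πʳ v : HeightOneSpectrum (𝓞 ↥(maximalRealSubfield L)), [↥(UnitaryGroup.localPi L (IsCMField.complexConj L) 3 H' v), UnitaryGroup.localInt L (IsCMField.complexConj L) 3 H' v]) :=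
    secondCountableTopology (fun v => (UnitaryGroup.localInt L (IsCMField.complexConj L) 3 H' v : Set ↥(UnitaryGroup.localPi L (IsCMField.complexConj L) 3 H' v))) fun v => UnitaryGroup.isOpen_localInt L (IsCMField.complexConj L) 3 H' v
  -- `ν_f` does not depend on the exceptional set: the model local Haar measures give `U(H′)(𝒪_v)` mass one at EVERY place (`hK`)
  have hν1 : ∀ v, (Measure.map (ψ v).symm (νG v)) (UnitaryGroup.localInt L (IsCMField.complexConj L) 3 H' v : Set ↥(UnitaryGroup.localPi L (IsCMField.complexConj L) 3 H' v)) = 1 :=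
    fun v => UnitaryGroup.map_localPiEquiv_symm_apply_localInt_eq_one v (ψ v) (congrFun hψ v) (νG v) (hK v)
  haveI hν'H : ∀ v, IsHaarMeasure (Measure.map (ψ v).symm (νG v)) := fun v => UnitaryGroup.isHaarMeasure_map_localModel_symm v (ψ v) (νG v)
  have hrp : ∀ S S' : Finset (HeightOneSpectrum (𝓞 ↥(maximalRealSubfield L))), rpMeasure (fun v => (UnitaryGroup.localInt L (IsCMField.complexConj L) 3 H' v : Set ↥(UnitaryGroup.localPi L (IsCMField.complexConj L) 3 H' v))) (fun v => (Measure.map (ψ v).symm (νG v))) S = rpMeasure (fun v => (UnitaryGroup.localInt L (IsCMField.complexConj L) 3 H' v : Set ↥(UnitaryGroup.localPi L (IsCMField.complexConj L) 3 H' v))) (fun v => (Measure.map (ψ v).symm (νG v))) S' := fun S S' =>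
    (rpMeasure_eq_of_subset (fun v => (UnitaryGroup.localInt L (IsCMField.complexConj L) 3 H' v : Set ↥(UnitaryGroup.localPi L (IsCMField.complexConj L) 3 H' v))) (fun v => (Measure.map (ψ v).symm (νG v))) (fun v => ⟨1, one_mem _⟩) (fun v => (UnitaryGroup.isOpen_localInt L (IsCMField.complexConj L) 3 H' v).measurableSet)
        (S₀' := S ∪ S') Finset.subset_union_left (fun v _ => hν1 v)).trans
      (rpMeasure_eq_of_subset (fun v => (UnitaryGroup.localInt L (IsCMField.complexConj L) 3 H' v : Set ↥(UnitaryGroup.localPi L (IsCMField.complexConj L) 3 H' v))) (fun v => (Measure.map (ψ v).symm (νG v))) (fun v => ⟨1, one_mem _⟩) (fun v => (UnitaryGroup.isOpen_localInt L (IsCMField.complexConj L) 3 H' v).measurableSet)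
        (S₀' := S ∪ S') Finset.subset_union_right (fun v _ => hν1 v)).symm
  haveI hνfH₁ : IsHaarMeasure (Measure.map (UnitaryGroup.finAdelicEquiv (↥(maximalRealSubfield L)) L (IsCMField.complexConj L) 3 H').symm.toMulEquiv (rpMeasure (fun v => (UnitaryGroup.localInt L (IsCMField.complexConj L) 3 H' v : Set ↥(UnitaryGroup.localPi L (IsCMField.complexConj L) 3 H' v))) (fun v => (Measure.map (ψ v).symm (νG v))) S₁)) := UnitaryGroup.isHaarMeasure_map_finAdelicEquiv_symm_rpMeasure (fun v => (Measure.map (ψ v).symm (νG v))) S₁ (fun v _ => hν1 v)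
  have hf0 : (Measure.map (UnitaryGroup.finAdelicEquiv (↥(maximalRealSubfield L)) L (IsCMField.complexConj L) 3 H').symm.toMulEquiv (rpMeasure (fun v => (UnitaryGroup.localInt L (IsCMField.complexConj L) 3 H' v : Set ↥(UnitaryGroup.localPi L (IsCMField.complexConj L) 3 H' v))) (fun v => (Measure.map (ψ v).symm (νG v))) S₁)) ≠ 0 := Measure.measure_univ_ne_zero.mp (isOpen_univ.measure_pos (μ := (Measure.map (UnitaryGroup.finAdelicEquiv (↥(maximalRealSubfield L)) L (IsCMField.complexConj L) 3 H').symm.toMulEquiv (rpMeasure (fun v => (UnitaryGroup.localInt L (IsCMField.complexConj L) 3 H' v : Set ↥(UnitaryGroup.localPi L (IsCMField.complexConj L) 3 H' v))) (fun v => (Measure.map (ψ v).symm (νG v))) S₁))) Set.univ_nonempty).ne'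
  -- ★ J1 at `c`
  obtain ⟨νi, νf, T, hνiH, hνiR, hνfH, hνfR, hTH, hTR, hTI, hνAR, hκTH, hκTI, hνA_c, hνf_c, hof_c, ρ, ρM, tf, tP, ht1, hρ, hρM, htf, htP, hT⟩ :=
    exists_covolTower_of_partners L H' hanis hherm νG hK mGs tGs hQ hCoh νGi νA ψ hψ e he' he hes hg c hreg hcen S₀ hS₀
  -- the archimedean measure is the reference one
  have hνf : νf = (Measure.map (UnitaryGroup.finAdelicEquiv (↥(maximalRealSubfield L)) L (IsCMField.complexConj L) 3 H').symm.toMulEquiv (rpMeasure (fun v => (UnitaryGroup.localInt L (IsCMField.complexConj L) 3 H' v : Set ↥(UnitaryGroup.localPi L (IsCMField.complexConj L) 3 H' v))) (fun v => (Measure.map (ψ v).symm (νG v))) S₁)) := by rw [hνf_c, hrp S₀ S₁]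
  have hνi : νi = νi₁ := by
    refine Literature.MeasureTheory.Measure.eq_of_map_mulEquiv_prod_eq e he hes hf0 ?_
    rw [← hνA₁, ← hνf, ← hνA_c]
  subst νi
  -- uniqueness of the Weil partner: `νZc = κ • T`
  haveI hLCA : LocallyCompactSpace ↥(Subgroup.centralizer ({((UnitaryGroup.cmDatum L 3 H').toAdelic (Quotient.out c))} : Set (UnitaryGroup.cmDatum L 3 H').Adelic)) := (isClosed_coe_centralizer_singleton _).isClosedEmbedding_subtypeVal.locallyCompactSpace
  have hκ0 : Measure.haarScalarFactor νi₁ νGi ≠ 0 := (Measure.haarScalarFactor_pos_of_isHaarMeasure νi₁ νGi).ne'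
  have hZ : νZc = Measure.haarScalarFactor νi₁ νGi • T :=
    isHaarMeasure_eq_of_quotientMeasure_eq (hH := isClosed_coe_centralizer_singleton _) _ νA νZc (Measure.haarScalarFactor νi₁ νGi • T) (hq.symm.trans hof_c)
  refine ⟨ρ, ρM, tf, tP, ht1, hρ, hρM, htf, htP, ?_⟩
  rw [hZ, smul_smul, inv_mul_cancel₀ hκ0, one_smul]
  exact hT

end PerClass

end Literature.NumberTheory.Rogawski1990

end
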